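import Literature.NumberTheory.EllipticCurves.Tian2014.CMPointSystemBridgeAut
import HarnessLib

/-!
# The generation sentence of Tian 2014, Prop. 4.6 («`Gal(H(i)/ℚ)` is generated by `Gal(H(i)/K(i))`, the complex
# conjugation, and the operator `σ_{1+ϖ}`») as a KERNEL THEOREM of the other displayed Galois facts — the displayed
# hypothesis of the route-A corner of record (`tian2014_system_sMinus_aut`, referee B ROUND 681) REDUCED by one printed
# sentence, with the reduced fact EQUIVALENT to the displayed one

Cell `bsd-monsky` (typer seat, g11). An idle-conjunct audit of the displayed hypothesis `hSys⁷ =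
tian2014_system_sMinus_aut` of the corner `congruentSilentEvenFiveBSDTwo_of_autSystem_descent` (referee B ROUND 681,
2026-08-27T10:21Z): every conjunct of `GrossZagierAut` (TYZ Thm. 3.3 at `χ₀`, TYZ p. 749, the bridge displays M1, M3, M5,
M6 and the split sentences of M2, M4, M7) and of `GenusTheoryDisplays` (19 conjuncts) is consumed by name in the kernel
chain to the datum, and so are `thm28_1`–`thm28_3`, `eq48` and five of the six conjuncts of `galoisFacts`; the
fourth conjunct of `galoisFacts` — Tian's generation sentence, Prop. 4.6 proof, «Note that the Galois group `Gal(H(i)/ℚ)`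
is generated by `Gal(H(i)/K(i))`, the complex conjugation, and the operator `σ_{1+ϖ}`» (arXiv:1210.8231 p0023 L26–L28)
— is consumed NOWHERE: the chain uses its fifth conjunct (the generation of the subgroup `Gal(H(i)/K)` of the
automorphisms fixing `√−2n` by `Gal(H(i)/K(i)) = {σ_t}` and `σ_{1+ϖ}`) instead. This file shows the fourth conjunct is a
KERNEL THEOREM of the fifth together with two displayed facts on complex conjugation (`conj(√−2n) = −√−2n`,
`conj² = 1`): for `σ ∈ Aut(H(i)/ℚ)`, `σ(√−2n)² = −2n` forces `σ(√−2n) = ±√−2n`; in the first case `σ ∈ ⟨{σ_t}, σ_{1+ϖ}⟩`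
by the fifth conjunct, in the second `conj∘σ` fixes `√−2n`, so `conj∘σ ∈ ⟨{σ_t}, σ_{1+ϖ}⟩` and `σ = conj∘(conj∘σ)`.
Hence `PrintedReduced ⟺ Printed` and `tian2014_system_sMinus_autReduced ⟺ tian2014_system_sMinus_aut`: the displayed
hypothesis of the corner is replaced by one with ONE printed sentence fewer (Tian's Prop. 4.6 generation sentence), the
marks of record (the readings P `tyzPhiParam` and M5 `tyzZN`, both inside `GrossZagierAut`, untouched) unchanged.

HONEST FRAMING (README §1 of the cell): nothing asserted; every `def … : Prop` below is a sub-conjunction of a display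
already in the tree (`CMPointSystemDisplays.lean`, `CMPointSystemBridgeAut.lean`) with the same locators; the kernel
content is elementary group theory in `Aut(H(i)/ℚ)`. No `_holds`; the conjecture `Prop`s stay `@[conjecture]`.
[cite: Tian2014, Def. 2.7 (p0011 L25–L36), Thm. 2.8 (p0011 L37–L44 = J132), §4.2 (p0022 L47–L60), Prop. 4.6 proof (p0023 L26–L28), (4.8) (p0023 L46–L50)]
[cite: Monsky1990MockHeegner, Def. 2.9 and Thm. 2.11 (p. 51), Remarks (2) (p. 62)]
-/

noncomputable section

open scoped Classical

open WeierstrassCurve NumberField Literature.NumberTheory.EllipticCurves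
  Literature.NumberTheory.EllipticCurves.TianYuanZhang2017

namespace Literature.NumberTheory.EllipticCurves.Tian2014

namespace CMPointData

variable {n : ℕ}

/-! ## §1 The reduced Galois facts (the generation sentence of Prop. 4.6 removed) -/

/-- **The Galois facts of Tian 2014 §2 / §4.2 WITHOUT the generation sentence of Prop. 4.6**: conjuncts 1, 2, 3, 5, 6
of `galoisFacts` — `σ_t` fixes `i` and `√−2n` («`σ_t` fixing `i`», Def. 2.7; `𝒜 ≅ Gal(H(i)/K(i))`, p0022 L56–L57);
`σ_{1+ϖ}` is «the involution of `H(i)/H`» (moves `i`, fixes `√−2n ∈ H`, squares to the identity); complex conjugation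
moves `i` and `√−2n` and is an involution; the subgroup `Gal(H(i)/K)` of the automorphisms fixing `√−2n` is generated by
`Gal(H(i)/K(i)) = {σ_t}` and `σ_{1+ϖ}` (`H(i) = H · K(i)` with `H ∩ K(i) = K`, «`i ∉ H`», p0022 L52–L53); `[ϖ′]` has order
`2` in `𝒜` and `[ϖ′] ≠ 1`. The removed fourth conjunct («`Gal(H(i)/ℚ)` is generated by `Gal(H(i)/K(i))`, the complex
conjugation, and the operator `σ_{1+ϖ}`», Prop. 4.6 proof, p0023 L26–L28) is PROVED from these in
`mem_closure_art_tau_conj_of_galoisFactsReduced`.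
[cite: Tian2014, Def. 2.7 (p0011 L35–L36), §4.2 (p0022 L52–L60), Prop. 4.6 proof (p0023 L26–L28)]
[cite: Monsky1990MockHeegner, p. 51 and Thm. 5.5 proof (p. 62)] -/
def galoisFactsReduced (D : CMPointData n) : Prop :=
  (∀ s, D.art s D.im = D.im ∧ D.art s D.sqrtNegTwoN = D.sqrtNegTwoN) ∧
  (D.tau D.im = -D.im ∧ D.tau D.sqrtNegTwoN = D.sqrtNegTwoN ∧ D.tau * D.tau = 1) ∧
  (D.conj D.im = -D.im ∧ D.conj D.sqrtNegTwoN = -D.sqrtNegTwoN ∧ D.conj * D.conj = 1) ∧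
  (∀ σ : D.H ≃ₐ[ℚ] D.H, σ D.sqrtNegTwoN = D.sqrtNegTwoN →
    σ ∈ Subgroup.closure (Set.range D.art ∪ {D.tau})) ∧
  (D.piPrime * D.piPrime = 1 ∧ D.piPrime ≠ 1)

/-- The reduced facts are a sub-conjunction of `galoisFacts` (projection). [cite: Tian2014, §4.2 (p0022 L52–L60)] [folklore] -/
theorem galoisFactsReduced_of_galoisFacts (D : CMPointData n) (h : D.galoisFacts) : D.galoisFactsReduced := by
  obtain ⟨h1, h2, h3, -, h5, h6⟩ := h
  exact ⟨h1, h2, h3, h5, h6⟩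

/-! ## §2 The kernel content: the generation sentence of Prop. 4.6 from the subgroup generation and conjugation -/

/-- Every `σ ∈ Aut(H(i)/ℚ)` sends `√−2n` to `±√−2n` (`σ(√−2n)² = σ(−2n) = −2n`, and `x² = y²` forces `x = ±y` in a field).
[cite: Tian2014, Def. 2.7 (p0011 L25–L27: `K = ℚ(√−2n)`)] [folklore] -/
theorem apply_sqrtNegTwoN_eq_or_eq_neg (D : CMPointData n) (σ : D.H ≃ₐ[ℚ] D.H) :
    σ D.sqrtNegTwoN = D.sqrtNegTwoN ∨ σ D.sqrtNegTwoN = -D.sqrtNegTwoN := by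
  have h : (σ D.sqrtNegTwoN) ^ 2 = D.sqrtNegTwoN ^ 2 := by
    rw [← map_pow, D.sqrtNegTwoN_sq, map_neg, map_natCast]
  exact sq_eq_sq_iff_eq_or_eq_neg.mp h

/-- **The generation sentence of Prop. 4.6 is a KERNEL THEOREM of the reduced Galois facts**: «the Galois group
`Gal(H(i)/ℚ)` is generated by `Gal(H(i)/K(i))`, the complex conjugation, and the operator `σ_{1+ϖ}`» — for
`σ ∈ Aut(H(i)/ℚ)`, either `σ` fixes `√−2n` and lies in `⟨{σ_t}, σ_{1+ϖ}⟩` by the fifth conjunct, or `σ(√−2n) = −√−2n`,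
then `conj∘σ` fixes `√−2n`, lies in `⟨{σ_t}, σ_{1+ϖ}⟩`, and `σ = conj∘(conj∘σ)` since `conj² = 1`.
[cite: Tian2014, Prop. 4.6 proof (p0023 L26–L28), §4.2 (p0022 L52–L60)] -/
theorem mem_closure_art_tau_conj_of_galoisFactsReduced (D : CMPointData n) (h : D.galoisFactsReduced)
    (σ : D.H ≃ₐ[ℚ] D.H) : σ ∈ Subgroup.closure (Set.range D.art ∪ {D.tau, D.conj}) := by
  obtain ⟨-, -, ⟨-, hconjθ, hconj2⟩, hgalK, -⟩ := h
  have hmono : Subgroup.closure (Set.range D.art ∪ {D.tau}) ≤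
      Subgroup.closure (Set.range D.art ∪ {D.tau, D.conj}) :=
    Subgroup.closure_mono
      (Set.union_subset_union_right _ (Set.singleton_subset_iff.mpr (Set.mem_insert _ _)))
  have hconj_mem : D.conj ∈ Subgroup.closure (Set.range D.art ∪ {D.tau, D.conj}) :=
    Subgroup.subset_closure (Or.inr (Set.mem_insert_of_mem _ (Set.mem_singleton _)))
  rcases D.apply_sqrtNegTwoN_eq_or_eq_neg σ with hσ | hσ
  · exact hmono (hgalK σ hσ)
  · have hfix : (D.conj * σ) D.sqrtNegTwoN = D.sqrtNegTwoN := by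
      rw [AlgEquiv.mul_apply, hσ, map_neg, hconjθ, neg_neg]
    have hmem : D.conj * σ ∈ Subgroup.closure (Set.range D.art ∪ {D.tau, D.conj}) :=
      hmono (hgalK _ hfix)
    have hσ' : σ = D.conj * (D.conj * σ) := by rw [← mul_assoc, hconj2, one_mul]
    rw [hσ']
    exact Subgroup.mul_mem _ hconj_mem hmem

/-- **`galoisFacts` from the reduced facts**: the removed generation sentence is supplied by
`mem_closure_art_tau_conj_of_galoisFactsReduced`. [cite: Tian2014, §4.2 (p0022 L52–L60), Prop. 4.6 proof (p0023 L26–L28)] -/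
theorem galoisFacts_of_galoisFactsReduced (D : CMPointData n) (h : D.galoisFactsReduced) : D.galoisFacts := by
  obtain ⟨h1, h2, h3, h5, h6⟩ := h
  exact ⟨h1, h2, h3, D.mem_closure_art_tau_conj_of_galoisFactsReduced ⟨h1, h2, h3, h5, h6⟩, h5, h6⟩

/-- The two forms of the Galois facts are equivalent. [cite: Tian2014, §4.2 (p0022 L52–L60), Prop. 4.6 proof (p0023 L26–L28)] -/
theorem galoisFacts_iff_galoisFactsReduced (D : CMPointData n) : D.galoisFacts ↔ D.galoisFactsReduced :=
  ⟨D.galoisFactsReduced_of_galoisFacts, D.galoisFacts_of_galoisFactsReduced⟩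

/-! ## §3 The reduced display of Tian 2014 §2 / §4.2 -/

/-- **The displayed statements of Tian 2014 §2 / §4.2 with the generation sentence of Prop. 4.6 removed**: Thm. 2.8
(1)–(3), (4.8) and `galoisFactsReduced`. Equivalent to `Printed` (`printed_iff_printedReduced`).
[cite: Tian2014, Thm. 2.8 (p0011 L37–L44), (4.8) (p0023 L46–L50), §4.2 (p0022 L52–L60)] -/
def PrintedReduced (D : CMPointData n) : Prop :=
  D.thm28_1 ∧ D.thm28_2 ∧ D.thm28_3 ∧ D.eq48 ∧ D.galoisFactsReduced

/-- `Printed ⟹ PrintedReduced` (projection). [cite: Tian2014, Thm. 2.8 (p0011 L37–L44)] [folklore] -/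
theorem printedReduced_of_printed (D : CMPointData n) (h : D.Printed) : D.PrintedReduced := by
  obtain ⟨h1, h2, h3, h4, h5⟩ := h
  exact ⟨h1, h2, h3, h4, D.galoisFactsReduced_of_galoisFacts h5⟩

/-- `PrintedReduced ⟹ Printed` (the generation sentence is a kernel theorem of the rest).
[cite: Tian2014, Thm. 2.8 (p0011 L37–L44), Prop. 4.6 proof (p0023 L26–L28)] -/
theorem printed_of_printedReduced (D : CMPointData n) (h : D.PrintedReduced) : D.Printed := by
  obtain ⟨h1, h2, h3, h4, h5⟩ := h
  exact ⟨h1, h2, h3, h4, D.galoisFacts_of_galoisFactsReduced h5⟩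

/-- The two displays are equivalent. [cite: Tian2014, Thm. 2.8 (p0011 L37–L44), Prop. 4.6 proof (p0023 L26–L28)] -/
theorem printed_iff_printedReduced (D : CMPointData n) : D.Printed ↔ D.PrintedReduced :=
  ⟨D.printedReduced_of_printed, D.printed_of_printedReduced⟩

end CMPointData

/-! ## §4 The aut system fact with the reduced display -/

/-- **THE AUT SYSTEM FACT WITH TIAN'S PROP. 4.6 GENERATION SENTENCE REMOVED**: as `tian2014_system_sMinus_aut` (Tian's
CM-point system on `𝒮⁻`: `GrossZagierAut` — TYZ Thm. 3.3 at `χ₀` + TYZ p. 749 through `ϕ` + the bridge displays with M2,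
M4, M7 split into printed sentences — and `GenusTheoryDisplays`) with `Printed` replaced by `PrintedReduced`: Thm. 2.8
(1)–(3), (4.8) and the Galois facts WITHOUT «`Gal(H(i)/ℚ)` is generated by `Gal(H(i)/K(i))`, the complex conjugation, and
the operator `σ_{1+ϖ}`» — a sentence no kernel theorem of the cell consumes and which the reduced facts prove. Existential
over ONE system per `(p, q)`; EQUIVALENT to `tian2014_system_sMinus_aut` (`tian2014_system_sMinus_aut_iff_autReduced`),
hence implies `…_param`, `…_cusp`, `…_maximal`, `…_bridged`, `…_split`, `…_genus` and every enclosure form of the cell.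
Printed-but-unproved content = that of the aut fact minus the one sentence. Nothing asserted; no `_holds` expected.
[cite: Tian2014, Def. 2.7, Thm. 2.8 (p0011 L25–L44 = J132), Prop. 2.1 (p0006 L23–L75 = J124 L25–J125 L35), p0007 L22–L29 (J126 L2–L7), p0003 L1–L5, §2 (p0005 L77–L79), §4.2 (p0022 L52–L60), (4.8) (p0023 L46–L50), Notations (J122–123)]
[cite: TianYuanZhang2017, Thm. 3.3 (p. 739) and its proof (pp. 749–751), §2 (p0007 L112), §3.1, §3.2 (p0012 L8–L18), J747, J751, Lemma 3.16 (p0017 L98–L113), Thm. 1.1, Thm. 1.4] -/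
def tian2014_system_sMinus_autReduced : Prop :=
  ∀ p q : ℕ, (hp : p.Prime) → (hq : q.Prime) → p % 8 = 5 → q % 4 = 3 → jacobiSym p q = -1 →
    ∃ D : CMPointData (p * q), D.PrintedReduced ∧
      D.GrossZagierAut (Nat.mul_ne_zero hp.ne_zero hq.ne_zero) ∧ D.GenusTheoryDisplays

/-- The reduced aut fact implies the aut fact (the generation sentence is a kernel theorem of the reduced facts).
[cite: Tian2014, Prop. 4.6 proof (p0023 L26–L28), §4.2 (p0022 L52–L60)] -/
theorem tian2014_system_sMinus_aut_of_autReduced (h : tian2014_system_sMinus_autReduced) :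
    tian2014_system_sMinus_aut := by
  intro p q hp hq hp5 hq4 hj
  obtain ⟨D, hP, hG, hGen⟩ := h p q hp hq hp5 hq4 hj
  exact ⟨D, D.printed_of_printedReduced hP, hG, hGen⟩

/-- The aut fact implies the reduced aut fact (projection). [cite: Tian2014, Thm. 2.8 (p0011 L37–L44)] [folklore] -/
theorem tian2014_system_sMinus_autReduced_of_aut (h : tian2014_system_sMinus_aut) :
    tian2014_system_sMinus_autReduced := by
  intro p q hp hq hp5 hq4 hj
  obtain ⟨D, hP, hG, hGen⟩ := h p q hp hq hp5 hq4 hj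
  exact ⟨D, D.printedReduced_of_printed hP, hG, hGen⟩

/-- The two aut facts are equivalent: the displayed hypothesis of the route-A corner of record may be read with or without
Tian's Prop. 4.6 generation sentence. [cite: Tian2014, Prop. 4.6 proof (p0023 L26–L28), §4.2 (p0022 L52–L60)] -/
theorem tian2014_system_sMinus_aut_iff_autReduced :
    tian2014_system_sMinus_aut ↔ tian2014_system_sMinus_autReduced :=
  ⟨tian2014_system_sMinus_autReduced_of_aut, tian2014_system_sMinus_aut_of_autReduced⟩

/-- The reduced aut fact implies the maximal fact. [cite: Tian2014, Prop. 2.1, Prop. 4.6 proof (p0023 L26–L28)] [cite: TianYuanZhang2017, §2, §3.2, Lemma 3.16] -/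
theorem tian2014_system_sMinus_maximal_of_autReduced (h : tian2014_system_sMinus_autReduced) :
    tian2014_system_sMinus_maximal :=
  tian2014_system_sMinus_maximal_of_aut (tian2014_system_sMinus_aut_of_autReduced h)

end Literature.NumberTheory.EllipticCurves.Tian2014

end
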